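import Literature.MathematicalPhysics.KineticTheory.EnskogRateConstMarkStatics
import Literature.MathematicalPhysics.KineticTheory.RelativeSpeedPairSums
import Literature.MathematicalPhysics.KineticTheory.CollisionTubeDensityWeight
import HarnessLib

/-!
# `L¹` law of large numbers for the Enskog rate functional at the constant mark, rung 0

Topic `Literature/MathematicalPhysics/KineticTheory` (kind proof; companion of `EnskogRateConstMarkStatics.lean`,
`EnskogRateConfigContinuity.lean`, `HardSphereUniformDensityLLN.lean`, `RelativeSpeedPairSums.lean`).  Under the rung-0
local Gibbs law `G_N` (constant profiles `a, u, θ`) of `N + 1` hard spheres of diameter `σ(N+1)^{-1/3}` on `𝕋³`, the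
Enskog rate functional at the CONSTANT mark (Enskog's collision frequency, Chapman–Cowling 1970 §16.4),
`e_t(z) = ∫ χ(t,x) ψ(σ³ρ_r(z,x)) B¹_r(z,x) dx` with `ψ = g·Y` and `B¹_r = (N+1)⁻² Σᵢⱼ bᵢ bⱼ π‖vᵢ − vⱼ‖`, converges
in `L¹(G_N)` to the deterministic value `(∫ χ(t,·)) ψ(σ³) π Θ̄`, `Θ̄ = E‖v − w‖` the mean relative speed of two
independent Maxwellian velocities, uniformly over `t ∈ [0, τ]`:

* `lintegral_enskogRate_one_sub_le` — the explicit estimate at one `N` (velocity `U`-statistic of the unbounded kernel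
  `π‖v − w‖` by the truncation bound `lintegral_enorm_weightedRelSpeedSum_sub_le`; position part by the deterministic
  estimate `abs_mul_offDiag_sub_le` plus the integrated variance of the mollified density);
* `exists_forall_lintegral_enskogRate_one_sub_le` — `∫⁻ ‖e_t − (∫χ(t,·)) ψ(σ³) πΘ̄‖ₑ dG_N ≤ ofReal ε` for `N ≥ N₀`.

Everything is written with lower Lebesgue integrals (Tonelli only).

## References

* S. Chapman, T. G. Cowling, *The Mathematical Theory of Non-Uniform Gases*, 3rd ed. (1970), §16.4.  [ChapmanCowling1970]
* H. Spohn, *Large Scale Dynamics of Interacting Particles* (1991), Part I §2.3.  [Spohn1991]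
-/

noncomputable section

open MeasureTheory ProbabilityTheory Set Filter Topology
open scoped ENNReal BigOperators

namespace Literature.MathematicalPhysics.KineticTheory

open Literature.Analysis.FluidPDE Literature.MathematicalPhysics.StatisticalMechanics

/-! ## The `L¹` estimate at one `N` -/

section Estimate

variable {σ a θ : ℝ} {u : V3}

/-- **The `L¹` deviation of the Enskog rate functional at the constant mark, at one `N`** (explicit form).  With
`ψ = g·Y` bounded by `K` on `[0, ∞)`, `|ψ(y) − ψ(σ³)| < ε'` for `|y − σ³| < δ'`, `M = 3/(πr³)`, `Θ̄ = E‖v − w‖`,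
`C₂ = E‖v − w‖²`, `|χ(t, ·)| ≤ C_χ` and any truncation level `L > 0`:
`∫⁻ ‖e_t − (∫χ(t,·)) ψ(σ³) πΘ̄‖ₑ dG_N ≤ ofReal (C_χ · [K(√(32(N+1)³W²L²) + 2πM²C₂/L)
  + πΘ̄((K(M+1)+1)ε' + (K(M+1)/(4ε') + 2Kσ⁶/δ'²) W_N + KM²/(N+1))])`, `W = πM²/(N+1)²`,
`W_N = ∫∫(ρ̃_r − 1)² dy dP_N`. [cite: ChapmanCowling1970, §16.4] -/
theorem lintegral_enskogRate_one_sub_le (hσ : 0 < σ) (hσ2 : σ ≤ 1 / 2) (ha : 0 < a) (hθ : 0 < θ) (N : ℕ)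
    (Φ : HardSphereFlow (Torus.geometry (Fin 3)) (hsDiameter σ N) (N + 1))
    {χ : ℝ × UnitAddTorus (Fin 3) → ℝ} (hχ : Continuous χ) {g : ℝ → ℝ} (hg : Continuous g)
    {K : ℝ} (hK : ∀ y, 0 ≤ y → |g y * contactValue y| ≤ K) {ε' δ' : ℝ} (hε' : 0 < ε') (hδ' : 0 < δ')
    (hcont : ∀ y, |y - σ ^ 3| < δ' → |g y * contactValue y - g (σ ^ 3) * contactValue (σ ^ 3)| < ε')
    {r : ℝ} (hr : 0 < r) {t Cχ : ℝ} (hCχ : ∀ x, |χ (t, x)| ≤ Cχ) {L : ℝ} (hL : 0 < L) :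
    ∫⁻ z, ‖enskogRate σ N χ g (fun _ => (1 : ℝ)) r t z -
        (∫ x, χ (t, x)) * (g (σ ^ 3) * contactValue (σ ^ 3)) *
          (Real.pi * ∫ p, ‖p.1 - p.2‖ ∂((gaussMeasure u θ).prod (gaussMeasure u θ)))‖ₑ
        ∂(localGibbsLaw σ (fun _ => a) (fun _ => u) (fun _ => θ) N Φ) ≤
      ENNReal.ofReal (Cχ * (K * (Real.sqrt (32 * (((N + 1 : ℕ) : ℝ)) ^ 3 *
          (Real.pi * ((((N + 1 : ℕ) : ℝ))⁻¹ * (((N + 1 : ℕ) : ℝ))⁻¹ * ((3 / (Real.pi * r ^ 3)) * (3 / (Real.pi * r ^ 3))))) ^ 2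
            * L ^ 2) +
          2 * (Real.pi * ((3 / (Real.pi * r ^ 3)) * (3 / (Real.pi * r ^ 3)))) *
            ((∫ p, ‖p.1 - p.2‖ ^ 2 ∂((gaussMeasure u θ).prod (gaussMeasure u θ))) / L)) +
        Real.pi * (∫ p, ‖p.1 - p.2‖ ∂((gaussMeasure u θ).prod (gaussMeasure u θ))) *
          ((K * (3 / (Real.pi * r ^ 3) + 1) + 1) * ε' +
            (K * (3 / (Real.pi * r ^ 3) + 1) / (4 * ε') + 2 * K * (σ ^ 3) ^ 2 / δ' ^ 2) *
              (∫ xs, (∫ y : T3, (empDensity r xs y - 1) ^ 2) ∂posGibbsMeasure (fun _ : T3 => a) (hsDiameter σ N) (N + 1)) +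
            K * (3 / (Real.pi * r ^ 3)) ^ 2 * (((N + 1 : ℕ) : ℝ))⁻¹))) := by
  -- notation
  set γ : Measure V3 := gaussMeasure u θ with hγ
  set Γ : Measure (Fin (N + 1) → V3) := Measure.pi fun _ : Fin (N + 1) => γ with hΓ
  set P : Measure (Fin (N + 1) → T3) := posGibbsMeasure (fun _ : T3 => a) (hsDiameter σ N) (N + 1) with hP
  set Θb : ℝ := ∫ p, ‖p.1 - p.2‖ ∂(γ.prod γ) with hΘb
  set C₂ : ℝ := ∫ p, ‖p.1 - p.2‖ ^ 2 ∂(γ.prod γ) with hC₂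
  set Mr : ℝ := 3 / (Real.pi * r ^ 3) with hMr
  set n : ℝ := ((N + 1 : ℕ) : ℝ) with hn
  set Wt : ℝ := Real.pi * (n⁻¹ * n⁻¹ * (Mr * Mr)) with hWt
  set St : ℝ := Real.pi * (Mr * Mr) with hSt
  set PSB : ℝ := Real.sqrt (32 * n ^ 3 * Wt ^ 2 * L ^ 2) + 2 * St * (C₂ / L) with hPSB
  set E₁ : ℝ := (K * (Mr + 1) + 1) * ε' with hE₁
  set C' : ℝ := K * (Mr + 1) / (4 * ε') + 2 * K * (σ ^ 3) ^ 2 / δ' ^ 2 with hC'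
  set E₂ : ℝ := K * Mr ^ 2 * n⁻¹ with hE₂
  set WN : ℝ := ∫ xs, (∫ y : T3, (empDensity r xs y - 1) ^ 2) ∂P with hWN
  set ψ : ℝ → ℝ := fun y => g y * contactValue y with hψ
  haveI hPprob : IsProbabilityMeasure P := by
    rw [hP]; exact isProbabilityMeasure_posGibbsMeasure continuous_const (fun _ => ha) hσ2 N
  haveI hGprob : IsProbabilityMeasure (localGibbsLaw σ (fun _ => a) (fun _ => u) (fun _ => θ) N Φ) :=
    isProbabilityMeasure_localGibbsLaw continuous_const continuous_const continuous_const (fun _ => ha) (fun _ => hθ)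
      hσ2 N Φ
  -- signs
  have hn0 : 0 < n := by rw [hn]; positivity
  have hMr0 : 0 ≤ Mr := by rw [hMr]; positivity
  have hK0 : 0 ≤ K := (abs_nonneg _).trans (hK 0 le_rfl)
  have hΘb0 : 0 ≤ Θb := integral_norm_sub_prod_gaussMeasure_nonneg u θ
  have hC₂0 : 0 ≤ C₂ := integral_nonneg fun _ => sq_nonneg _
  have hCχ0 : 0 ≤ Cχ := (abs_nonneg _).trans (hCχ 0)
  have hs : 0 < σ ^ 3 := pow_pos hσ 3
  have hSt0 : 0 ≤ St := by rw [hSt]; positivity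
  have hPSB0 : 0 ≤ PSB := by rw [hPSB]; positivity
  have hE₁0 : 0 ≤ E₁ := by rw [hE₁]; positivity
  have hC'0 : 0 ≤ C' := by rw [hC']; positivity
  have hE₂0 : 0 ≤ E₂ := by rw [hE₂]; positivity
  have hWN0 : 0 ≤ WN := integral_nonneg fun xs => integral_nonneg fun y => sq_nonneg _
  -- the pair weights
  set w : (Fin (N + 1) → T3) → T3 → Fin (N + 1) → Fin (N + 1) → ℝ := fun xs y a b =>
    if a = b then (0 : ℝ) else Real.pi * (n⁻¹ * n⁻¹ * (coneKernel r (xs a) y * coneKernel r (xs b) y)) with hw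
  have hwW : ∀ xs y a b, |w xs y a b| ≤ Wt := fun xs y a b => abs_pairWeight_le hr xs y a b
  have hwS : ∀ xs y, ∑ a, ∑ b, |w xs y a b| ≤ St := fun xs y => sum_abs_pairWeight_le hr xs y
  have hwdiag : ∀ xs y a, w xs y a a = 0 := fun xs y a => by rw [hw]; exact if_pos rfl
  -- measurability
  have hψm : Measurable ψ := by
    have hY : Measurable contactValue := by unfold contactValue; exact (measurable_deriv _).const_mul _
    exact hg.measurable.mul hY
  have hρm : Measurable fun q : Config (N + 1) (Fin 3) T3 × T3 => mollDensity r q.1 q.2 := by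
    simp_rw [mollDensity_eq_avg]
    refine measurable_const.mul (Finset.measurable_sum _ fun i _ => ?_)
    exact measurable_coneKernel_comp r ((measurable_pi_apply i).comp measurable_fst).fst measurable_snd
  have hBm : Measurable fun q : Config (N + 1) (Fin 3) T3 × T3 => pairFunctional r (fun _ => (1 : ℝ)) q.1 q.2 := by
    simp_rw [pairFunctional_one_eq_sum]
    refine measurable_const.mul (Finset.measurable_sum _ fun i _ => Finset.measurable_sum _ fun j _ => ?_)
    refine ((measurable_coneKernel_comp r ((measurable_pi_apply i).comp measurable_fst).fst measurable_snd).mul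
      (measurable_coneKernel_comp r ((measurable_pi_apply j).comp measurable_fst).fst measurable_snd)).mul ?_
    exact measurable_const.mul (((measurable_pi_apply i).comp measurable_fst).snd.sub
      ((measurable_pi_apply j).comp measurable_fst).snd).norm
  set D : Config (N + 1) (Fin 3) T3 → T3 → ℝ := fun z y =>
    ψ (σ ^ 3 * mollDensity r z y) * pairFunctional r (fun _ => (1 : ℝ)) z y - ψ (σ ^ 3) * (Real.pi * Θb) with hD
  have hDm : Measurable fun q : Config (N + 1) (Fin 3) T3 × T3 => D q.1 q.2 :=
    ((hψm.comp (measurable_const.mul hρm)).mul hBm).sub measurable_const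
  -- STEP A: pointwise in `z`
  have hA : ∀ z : Config (N + 1) (Fin 3) T3,
      ‖enskogRate σ N χ g (fun _ => (1 : ℝ)) r t z - (∫ x, χ (t, x)) * ψ (σ ^ 3) * (Real.pi * Θb)‖ₑ ≤
        ENNReal.ofReal Cχ * ∫⁻ y, ‖D z y‖ₑ := by
    intro z
    have hI1 : Integrable (fun y : T3 => χ (t, y) * (ψ (σ ^ 3 * mollDensity r z y) *
        pairFunctional r (fun _ => (1 : ℝ)) z y)) := by
      have h := integrable_enskogIntegrand (N := N) hχ hg hK hσ.le hr measurable_sphereMark_one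
        (fun v w => abs_sphereMark_one_le v w) t z
      refine h.congr (ae_of_all _ fun y => ?_)
      simp only [hψ]; ring
    have hI2 : Integrable (fun y : T3 => χ (t, y) * (ψ (σ ^ 3) * (Real.pi * Θb))) :=
      (integrable_of_continuous_T3 (hχ.comp (continuous_const.prodMk continuous_id))).mul_const _
    have he : enskogRate σ N χ g (fun _ => (1 : ℝ)) r t z - (∫ x, χ (t, x)) * ψ (σ ^ 3) * (Real.pi * Θb) =
        ∫ y, χ (t, y) * D z y := by
      have h1 : enskogRate σ N χ g (fun _ => (1 : ℝ)) r t z = ∫ y, χ (t, y) * (ψ (σ ^ 3 * mollDensity r z y) *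
          pairFunctional r (fun _ => (1 : ℝ)) z y) := by
        unfold enskogRate
        exact integral_congr_ae (ae_of_all _ fun y => by simp only [hψ]; ring)
      have h2 : (∫ x, χ (t, x)) * ψ (σ ^ 3) * (Real.pi * Θb) = ∫ y, χ (t, y) * (ψ (σ ^ 3) * (Real.pi * Θb)) := by
        rw [integral_mul_const]; ring
      rw [h1, h2, ← integral_sub hI1 hI2]
      refine integral_congr_ae (ae_of_all _ fun y => ?_)
      simp only [hD]; ring
    rw [he]
    calc ‖∫ y, χ (t, y) * D z y‖ₑ ≤ ∫⁻ y, ‖χ (t, y) * D z y‖ₑ := enorm_integral_le_lintegral_enorm _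
      _ ≤ ∫⁻ y, ENNReal.ofReal Cχ * ‖D z y‖ₑ := by
          refine lintegral_mono fun y => ?_
          rw [enorm_mul, Real.enorm_eq_ofReal_abs]
          exact mul_le_mul_left (ENNReal.ofReal_le_ofReal (hCχ y)) _
      _ = ENNReal.ofReal Cχ * ∫⁻ y, ‖D z y‖ₑ := lintegral_const_mul' _ _ ENNReal.ofReal_ne_top
  -- STEP E/F/G: the static estimate at one point `y`
  have hstatic : ∀ y : T3, ∫⁻ z, ‖D z y‖ₑ ∂(localGibbsLaw σ (fun _ => a) (fun _ => u) (fun _ => θ) N Φ) ≤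
      ENNReal.ofReal (K * PSB) + ENNReal.ofReal (Real.pi * Θb * (E₁ + E₂)) +
        ENNReal.ofReal (Real.pi * Θb * C') * ∫⁻ xs, ENNReal.ofReal ((empDensity r xs y - 1) ^ 2) ∂P := by
    intro y
    rw [lintegral_localGibbsLaw_rung0 σ ha.le hθ u N Φ (F := fun z => ‖D z y‖ₑ)
      (hDm.comp (measurable_id.prodMk measurable_const)).enorm]
    -- pointwise in `(xs, vs)`
    have hpt : ∀ (xs : Fin (N + 1) → T3) (vs : Fin (N + 1) → V3),
        ‖D (zipConfig (xs, vs)) y‖ₑ ≤ ENNReal.ofReal K * ‖∑ a, ∑ b, w xs y a b * (‖vs a - vs b‖ - Θb)‖ₑ +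
          ENNReal.ofReal (Real.pi * Θb * (E₁ + C' * (empDensity r xs y - 1) ^ 2 + E₂)) := by
      intro xs vs
      have hb : ∀ i, 0 ≤ coneKernel r (xs i) y ∧ coneKernel r (xs i) y ≤ Mr := fun i => coneKernel_mem_Icc hr _ _
      have hρ : mollDensity r (zipConfig (xs, vs)) y = empDensity r xs y := by
        rw [mollDensity_eq_empDensity]; rfl
      have hρ' : empDensity r xs y = n⁻¹ * ∑ i, coneKernel r (xs i) y := rfl
      have hρ0 : 0 ≤ σ ^ 3 * empDensity r xs y :=
        mul_nonneg hs.le (by rw [hρ']; exact mul_nonneg (inv_nonneg.2 hn0.le) (Finset.sum_nonneg fun i _ => (hb i).1))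
      have hB := pairFunctional_one_zipConfig_eq r xs vs y Θb
      have hSw := sum_pairWeight_eq r xs y
      have hdec : D (zipConfig (xs, vs)) y = ψ (σ ^ 3 * empDensity r xs y) * (∑ a, ∑ b, w xs y a b * (‖vs a - vs b‖ - Θb)) +
          Real.pi * Θb * (ψ (σ ^ 3 * (n⁻¹ * ∑ i, coneKernel r (xs i) y)) *
            (n⁻¹ * n⁻¹ * ∑ a, ∑ b, if a = b then 0 else coneKernel r (xs a) y * coneKernel r (xs b) y) - ψ (σ ^ 3)) := by
        rw [hD]; dsimp only
        rw [hρ, hB, hSw, ← hρ']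
        ring
      have hoff := abs_mul_offDiag_sub_le hK hMr0 hs hε' hδ' hcont (fun i => coneKernel r (xs i) y) hb
      rw [hdec]
      refine (enorm_add_le _ _).trans (add_le_add ?_ ?_)
      · rw [enorm_mul, Real.enorm_eq_ofReal_abs]
        exact mul_le_mul_left (ENNReal.ofReal_le_ofReal (hK _ hρ0)) _
      · rw [enorm_mul, Real.enorm_eq_ofReal_abs, Real.enorm_eq_ofReal_abs, ← ENNReal.ofReal_mul (abs_nonneg _),
          abs_of_nonneg (by positivity : 0 ≤ Real.pi * Θb)]
        refine ENNReal.ofReal_le_ofReal (mul_le_mul_of_nonneg_left (hoff.trans (le_of_eq ?_)) (by positivity))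
        rw [← hρ', hE₁, hC', hE₂]
    -- integrate in the velocities
    have hvel : ∀ xs : Fin (N + 1) → T3, ∫⁻ vs, ‖D (zipConfig (xs, vs)) y‖ₑ ∂Γ ≤
        ENNReal.ofReal (K * PSB) + ENNReal.ofReal (Real.pi * Θb * (E₁ + C' * (empDensity r xs y - 1) ^ 2 + E₂)) := by
      intro xs
      have hPSm : Measurable fun vs : Fin (N + 1) → V3 =>
          ENNReal.ofReal K * ‖∑ a, ∑ b, w xs y a b * (‖vs a - vs b‖ - Θb)‖ₑ := by
        refine measurable_const.mul (Measurable.enorm ?_)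
        refine Finset.measurable_sum _ fun a _ => Finset.measurable_sum _ fun b _ => ?_
        exact measurable_const.mul (((measurable_pi_apply a).sub (measurable_pi_apply b)).norm.sub measurable_const)
      have hps := lintegral_enorm_weightedRelSpeedSum_sub_le (n := N + 1) u θ (hwW xs y) (hwS xs y) (hwdiag xs y) hL
      calc ∫⁻ vs, ‖D (zipConfig (xs, vs)) y‖ₑ ∂Γ
          ≤ ∫⁻ vs, (ENNReal.ofReal K * ‖∑ a, ∑ b, w xs y a b * (‖vs a - vs b‖ - Θb)‖ₑ +
              ENNReal.ofReal (Real.pi * Θb * (E₁ + C' * (empDensity r xs y - 1) ^ 2 + E₂))) ∂Γ :=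
            lintegral_mono fun vs => hpt xs vs
        _ = ENNReal.ofReal K * ∫⁻ vs, ‖∑ a, ∑ b, w xs y a b * (‖vs a - vs b‖ - Θb)‖ₑ ∂Γ +
              ENNReal.ofReal (Real.pi * Θb * (E₁ + C' * (empDensity r xs y - 1) ^ 2 + E₂)) := by
            rw [lintegral_add_left hPSm, lintegral_const_mul' _ _ ENNReal.ofReal_ne_top, lintegral_const, measure_univ,
              mul_one]
        _ ≤ ENNReal.ofReal K * ENNReal.ofReal PSB +
              ENNReal.ofReal (Real.pi * Θb * (E₁ + C' * (empDensity r xs y - 1) ^ 2 + E₂)) :=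
            add_le_add_left (mul_le_mul_right hps _) _
        _ = _ := by rw [← ENNReal.ofReal_mul hK0]
    -- integrate in the positions
    have hposm : Measurable fun xs : Fin (N + 1) → T3 => ENNReal.ofReal ((empDensity r xs y - 1) ^ 2) :=
      ((measurable_sq_empDensity_sub_one r).comp (measurable_id.prodMk measurable_const)).ennreal_ofReal
    calc ∫⁻ xs, ∫⁻ vs, ‖D (zipConfig (xs, vs)) y‖ₑ ∂Γ ∂P
        ≤ ∫⁻ xs, (ENNReal.ofReal (K * PSB) + ENNReal.ofReal (Real.pi * Θb * (E₁ + E₂)) +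
            ENNReal.ofReal (Real.pi * Θb * C') * ENNReal.ofReal ((empDensity r xs y - 1) ^ 2)) ∂P := by
          refine lintegral_mono fun xs => (hvel xs).trans (le_of_eq ?_)
          have e : Real.pi * Θb * (E₁ + C' * (empDensity r xs y - 1) ^ 2 + E₂) =
              Real.pi * Θb * (E₁ + E₂) + Real.pi * Θb * C' * (empDensity r xs y - 1) ^ 2 := by ring
          rw [e, ENNReal.ofReal_add (by positivity) (by positivity),
            ENNReal.ofReal_mul (p := Real.pi * Θb * C') (by positivity), add_assoc]
      _ = ENNReal.ofReal (K * PSB) + ENNReal.ofReal (Real.pi * Θb * (E₁ + E₂)) +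
            ENNReal.ofReal (Real.pi * Θb * C') * ∫⁻ xs, ENNReal.ofReal ((empDensity r xs y - 1) ^ 2) ∂P := by
          rw [lintegral_add_left (measurable_const), lintegral_const, measure_univ, mul_one,
            lintegral_const_mul' _ _ ENNReal.ofReal_ne_top]
  -- STEP H: the integrated variance of the mollified density
  have hWNeq : ∫⁻ y, ∫⁻ xs, ENNReal.ofReal ((empDensity r xs y - 1) ^ 2) ∂P = ENNReal.ofReal WN := by
    have hsw := lintegral_lintegral_swap (μ := (volume : Measure T3)) (ν := P)
      (f := fun (y : T3) (xs : Fin (N + 1) → T3) => ENNReal.ofReal ((empDensity r xs y - 1) ^ 2))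
      (((measurable_sq_empDensity_sub_one r).comp measurable_swap).ennreal_ofReal.aemeasurable)
    rw [hsw]
    have hinner : ∀ xs : Fin (N + 1) → T3, ∫⁻ y, ENNReal.ofReal ((empDensity r xs y - 1) ^ 2) =
        ENNReal.ofReal (∫ y, (empDensity r xs y - 1) ^ 2) := by
      intro xs
      have hcont : Continuous fun y => (empDensity r xs y - 1) ^ 2 :=
        (((continuous_empDensity (n := N + 1) r).comp (Continuous.prodMk_right xs)).sub continuous_const).pow 2
      rw [← ofReal_integral_eq_lintegral_ofReal (integrable_of_continuous_T3 hcont) (ae_of_all _ fun y => sq_nonneg _)]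
    simp_rw [hinner]
    have hbd : ∀ (xs : Fin (N + 1) → T3) (y : T3), |(empDensity r xs y - 1) ^ 2| ≤ (Mr + 1) ^ 2 := by
      intro xs y
      obtain ⟨h0, h1⟩ := empDensity_mem_Icc hr xs y
      rw [abs_of_nonneg (sq_nonneg _), ← sq_abs]
      refine pow_le_pow_left₀ (abs_nonneg _) ?_ 2
      rw [abs_le]; constructor <;> linarith
    have hIm : Measurable fun xs : Fin (N + 1) → T3 => ∫ y, (empDensity r xs y - 1) ^ 2 :=
      ((measurable_sq_empDensity_sub_one r).stronglyMeasurable.integral_prod_right' (ν := (volume : Measure T3))).measurable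
    have hI0 : ∀ xs : Fin (N + 1) → T3, 0 ≤ ∫ y, (empDensity r xs y - 1) ^ 2 := fun xs => integral_nonneg fun y => sq_nonneg _
    have hIb : ∀ xs : Fin (N + 1) → T3, ∫ y, (empDensity r xs y - 1) ^ 2 ≤ (Mr + 1) ^ 2 := fun xs => by
      have h' := norm_integral_le_of_norm_le_const (μ := (volume : Measure T3))
        (f := fun y => (empDensity r xs y - 1) ^ 2) (C := (Mr + 1) ^ 2)
        (ae_of_all _ fun y => by rw [Real.norm_eq_abs]; exact hbd xs y)
      rw [probReal_univ, mul_one, Real.norm_eq_abs] at h'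
      exact (le_abs_self _).trans h'
    have hIint : Integrable (fun xs : Fin (N + 1) → T3 => ∫ y, (empDensity r xs y - 1) ^ 2) P :=
      Integrable.of_bound hIm.aestronglyMeasurable ((Mr + 1) ^ 2)
        (ae_of_all _ fun xs => by rw [Real.norm_eq_abs, abs_of_nonneg (hI0 xs)]; exact hIb xs)
    rw [← ofReal_integral_eq_lintegral_ofReal hIint (ae_of_all _ hI0)]
  -- ASSEMBLY
  calc ∫⁻ z, ‖enskogRate σ N χ g (fun _ => (1 : ℝ)) r t z - (∫ x, χ (t, x)) * ψ (σ ^ 3) * (Real.pi * Θb)‖ₑ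
        ∂(localGibbsLaw σ (fun _ => a) (fun _ => u) (fun _ => θ) N Φ)
      ≤ ∫⁻ z, (ENNReal.ofReal Cχ * ∫⁻ y, ‖D z y‖ₑ) ∂(localGibbsLaw σ (fun _ => a) (fun _ => u) (fun _ => θ) N Φ) :=
        lintegral_mono hA
    _ = ENNReal.ofReal Cχ * ∫⁻ y, (∫⁻ z, ‖D z y‖ₑ ∂(localGibbsLaw σ (fun _ => a) (fun _ => u) (fun _ => θ) N Φ)) := by
        rw [lintegral_const_mul' _ _ ENNReal.ofReal_ne_top, lintegral_lintegral_swap hDm.enorm.aemeasurable]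
    _ ≤ ENNReal.ofReal Cχ * ∫⁻ y : T3, (ENNReal.ofReal (K * PSB) + ENNReal.ofReal (Real.pi * Θb * (E₁ + E₂)) +
          ENNReal.ofReal (Real.pi * Θb * C') * ∫⁻ xs, ENNReal.ofReal ((empDensity r xs y - 1) ^ 2) ∂P) :=
        mul_le_mul_right (lintegral_mono hstatic) _
    _ = ENNReal.ofReal Cχ * (ENNReal.ofReal (K * PSB) + ENNReal.ofReal (Real.pi * Θb * (E₁ + E₂)) +
          ENNReal.ofReal (Real.pi * Θb * C') * ENNReal.ofReal WN) := by
        rw [lintegral_add_left measurable_const, lintegral_const, measure_univ, mul_one,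
          lintegral_const_mul' _ _ ENNReal.ofReal_ne_top, hWNeq]
    _ = ENNReal.ofReal (Cχ * (K * PSB + Real.pi * Θb * (E₁ + C' * WN + E₂))) := by
        rw [← ENNReal.ofReal_mul (by positivity), ← ENNReal.ofReal_add (by positivity) (by positivity),
          ← ENNReal.ofReal_add (by positivity) (by positivity), ← ENNReal.ofReal_mul hCχ0]
        congr 1; ring

/-- **`L¹` law of large numbers for the Enskog rate functional at the constant mark, rung 0** (the limit form).
At small reduced density, for constant profiles `a, θ > 0`, `u`, continuous `χ, g` with `ψ = g·Y` bounded on `[0, ∞)`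
and continuous at `σ³`, `0 < r < 1/2`, any horizon `τ` and `ε > 0`: there is `N₀` such that for `N ≥ N₀`, every flow
and every `t ∈ [0, τ]`, `∫⁻ ‖e_t − (∫χ(t,·)) ψ(σ³) π E‖v − w‖‖ₑ dG_N ≤ ofReal ε`.
Order of choices: `ε'` (continuity scale), `δ'`, the truncation level `L`, then `N₀` (velocity `U`-statistic,
`(N+1)⁻¹` terms, integrated variance of the mollified density). [cite: ChapmanCowling1970, §16.4] -/
theorem exists_forall_lintegral_enskogRate_one_sub_le (hsd : SmallDensity uniformProfile σ) (ha : 0 < a)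
    (hθ : 0 < θ) (u : V3) {χ : ℝ × UnitAddTorus (Fin 3) → ℝ} (hχ : Continuous χ) {g : ℝ → ℝ} (hg : Continuous g)
    {K : ℝ} (hK : ∀ y, 0 ≤ y → |g y * contactValue y| ≤ K)
    (hψc : ContinuousAt (fun y => g y * contactValue y) (σ ^ 3)) {r : ℝ} (hr : 0 < r) (hr2 : r < 1 / 2)
    (τ : ℝ) {ε : ℝ} (hε : 0 < ε) :
    ∃ N₀ : ℕ, ∀ N : ℕ, N₀ ≤ N → ∀ Φ : HardSphereFlow (Torus.geometry (Fin 3)) (hsDiameter σ N) (N + 1),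
      ∀ t ∈ Set.Icc (0 : ℝ) τ,
        ∫⁻ z, ‖enskogRate σ N χ g (fun _ => (1 : ℝ)) r t z -
            (∫ x, χ (t, x)) * (g (σ ^ 3) * contactValue (σ ^ 3)) *
              (Real.pi * ∫ p, ‖p.1 - p.2‖ ∂((gaussMeasure u θ).prod (gaussMeasure u θ)))‖ₑ
          ∂(localGibbsLaw σ (fun _ => a) (fun _ => u) (fun _ => θ) N Φ) ≤ ENNReal.ofReal ε := by
  have hσ : 0 < σ := hsd.σ_pos
  have hσ2 : σ ≤ 1 / 2 := hsd.σ_lt_half.le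
  -- `χ` is bounded on `[0, τ] × 𝕋³`
  have hKc : IsCompact (Set.Icc (0 : ℝ) τ ×ˢ (univ : Set (UnitAddTorus (Fin 3)))) := isCompact_Icc.prod isCompact_univ
  obtain ⟨Cχ, hCχ⟩ := hKc.exists_bound_of_continuousOn hχ.continuousOn
  set A : ℝ := max Cχ 0 + 1 with hA
  have hA0 : 0 < A := by rw [hA]; positivity
  have hχA : ∀ t ∈ Set.Icc (0 : ℝ) τ, ∀ x, |χ (t, x)| ≤ A := fun t ht x => by
    have h := hCχ (t, x) ⟨ht, mem_univ _⟩
    rw [Real.norm_eq_abs] at h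
    exact h.trans ((le_max_left _ _).trans (by rw [hA]; linarith))
  -- constants
  set Θb : ℝ := ∫ p, ‖p.1 - p.2‖ ∂((gaussMeasure u θ).prod (gaussMeasure u θ)) with hΘb
  set C₂ : ℝ := ∫ p, ‖p.1 - p.2‖ ^ 2 ∂((gaussMeasure u θ).prod (gaussMeasure u θ)) with hC₂
  set Mr : ℝ := 3 / (Real.pi * r ^ 3) with hMr
  set St : ℝ := Real.pi * (Mr * Mr) with hSt
  have hK0 : 0 ≤ K := (abs_nonneg _).trans (hK 0 le_rfl)
  have hΘb0 : 0 ≤ Θb := integral_norm_sub_prod_gaussMeasure_nonneg u θ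
  have hC₂0 : 0 ≤ C₂ := integral_nonneg fun _ => sq_nonneg _
  have hMr0 : 0 ≤ Mr := by rw [hMr]; positivity
  have hSt0 : 0 ≤ St := by rw [hSt]; positivity
  set B : ℝ := Real.pi * Θb + 1 with hB
  have hB0 : 0 < B := by rw [hB]; positivity
  have hπΘB : Real.pi * Θb ≤ B := by rw [hB]; linarith
  -- `ε'`, `δ'`
  set ε' : ℝ := ε / (4 * A * B * (K * (Mr + 1) + 1)) with hε'
  have hε'0 : 0 < ε' := by rw [hε']; positivity
  obtain ⟨δ', hδ'0, hδ'⟩ := Metric.continuousAt_iff.1 hψc ε' hε'0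
  have hcont : ∀ y, |y - σ ^ 3| < δ' → |g y * contactValue y - g (σ ^ 3) * contactValue (σ ^ 3)| < ε' :=
    fun y hy => by have h := hδ' (by rwa [Real.dist_eq]); rwa [Real.dist_eq] at h
  set C' : ℝ := K * (Mr + 1) / (4 * ε') + 2 * K * (σ ^ 3) ^ 2 / δ' ^ 2 with hC'
  have hC'0 : 0 ≤ C' := by rw [hC']; positivity
  -- `L`
  set L : ℝ := 8 * A * K * St * C₂ / ε + 1 with hL
  have hL0 : 0 < L := by rw [hL]; positivity
  have hLterm : A * (K * (2 * St * (C₂ / L))) ≤ ε / 4 := by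
    have h1 : 8 * A * K * St * C₂ ≤ ε * L := by
      have e : ε * L = 8 * A * K * St * C₂ + ε := by rw [hL]; field_simp
      rw [e]; linarith
    rw [show A * (K * (2 * St * (C₂ / L))) = (2 * A * K * St * C₂) / L by ring, div_le_iff₀ hL0]
    nlinarith
  have hE₁term : A * (B * ((K * (Mr + 1) + 1) * ε')) = ε / 4 := by
    rw [hε']; field_simp
  -- the `N`-dependent terms tend to zero
  have hinv : Tendsto (fun N : ℕ => (((N + 1 : ℕ) : ℝ))⁻¹) atTop (𝓝 0) :=
    tendsto_inv_atTop_zero.comp ((tendsto_natCast_atTop_atTop (R := ℝ)).comp (tendsto_add_atTop_nat 1))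
  have hsqrt : Tendsto (fun N : ℕ => Real.sqrt (32 * (((N + 1 : ℕ) : ℝ)) ^ 3 *
      (Real.pi * ((((N + 1 : ℕ) : ℝ))⁻¹ * (((N + 1 : ℕ) : ℝ))⁻¹ * (Mr * Mr))) ^ 2 * L ^ 2)) atTop (𝓝 0) := by
    have h1 : Tendsto (fun N : ℕ => 32 * Real.pi ^ 2 * Mr ^ 4 * L ^ 2 * (((N + 1 : ℕ) : ℝ))⁻¹) atTop (𝓝 0) := by
      simpa using hinv.const_mul (32 * Real.pi ^ 2 * Mr ^ 4 * L ^ 2)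
    have h2 := h1.sqrt
    rw [Real.sqrt_zero] at h2
    refine h2.congr fun N => ?_
    congr 1
    have hN : (((N + 1 : ℕ) : ℝ)) ≠ 0 := by positivity
    field_simp
  have hW := tendsto_integral_integral_sq_empDensity_sub_one hsd ha hr hr2
  -- the total bound and its limit
  set f : ℕ → ℝ := fun N => A * (K * (Real.sqrt (32 * (((N + 1 : ℕ) : ℝ)) ^ 3 *
      (Real.pi * ((((N + 1 : ℕ) : ℝ))⁻¹ * (((N + 1 : ℕ) : ℝ))⁻¹ * (Mr * Mr))) ^ 2 * L ^ 2) + 2 * St * (C₂ / L)) +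
    Real.pi * Θb * ((K * (Mr + 1) + 1) * ε' + C' *
      (∫ xs, (∫ y : T3, (empDensity r xs y - 1) ^ 2) ∂posGibbsMeasure (fun _ : T3 => a) (hsDiameter σ N) (N + 1)) +
      K * Mr ^ 2 * (((N + 1 : ℕ) : ℝ))⁻¹)) with hf
  have hflim : Tendsto f atTop (𝓝 (A * (K * (0 + 2 * St * (C₂ / L)) +
      Real.pi * Θb * ((K * (Mr + 1) + 1) * ε' + C' * 0 + K * Mr ^ 2 * 0)))) := by
    rw [hf]
    refine Tendsto.const_mul A (Tendsto.add (Tendsto.const_mul K (hsqrt.add tendsto_const_nhds)) ?_)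
    exact Tendsto.const_mul _ ((tendsto_const_nhds.add (hW.const_mul C')).add (hinv.const_mul _))
  have hlim_lt : A * (K * (0 + 2 * St * (C₂ / L)) + Real.pi * Θb * ((K * (Mr + 1) + 1) * ε' + C' * 0 + K * Mr ^ 2 * 0)) < ε := by
    rw [zero_add, mul_zero, mul_zero, add_zero, add_zero]
    have h2 : A * (Real.pi * Θb * ((K * (Mr + 1) + 1) * ε')) ≤ ε / 4 := by
      rw [← hE₁term]
      exact mul_le_mul_of_nonneg_left (mul_le_mul_of_nonneg_right hπΘB (by positivity)) hA0.le
    rw [mul_add]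
    linarith
  obtain ⟨N₀, hN₀⟩ := eventually_atTop.1 (hflim.eventually (gt_mem_nhds hlim_lt))
  refine ⟨N₀, fun N hN Φ t ht => ?_⟩
  have hmain := lintegral_enskogRate_one_sub_le (u := u) hσ hσ2 ha hθ N Φ hχ hg hK hε'0 hδ'0 hcont hr (hχA t ht) hL0
  refine hmain.trans (ENNReal.ofReal_le_ofReal ?_)
  have h := (hN₀ N hN).le
  rw [hf] at h
  exact h

end Estimate

end Literature.MathematicalPhysics.KineticTheory

end
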